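/-
Copyright (c) 2026 the pub-hodgecm-mathlib formalisation cell (harness21).  Prover seat hodgecm-mathlib-LH4-p09 (g2), req620 Track A «(D-RAM) FOUR-FRAME» squad
(unit U3_Laws, MS ROAD A STAGE B brick B0 «DATUM LEMMAS» of LH4-p10 (g2)'s MEMO-stableLaw-finite v2 §2∕§9).  One-field datum currency.  2026-09-03.
-/
import Literature.NumberTheory.LocalFields.WildQuadraticDatumNormGradedSteps    -- ★ p855352 (this seat): `exists_fixed_v_sub_le`, `map_mul_map`, `v_normVarpi_pow`; brings ★ `WildQuadraticDatumTrace` (`sub_map_ne_zero`, `map_varpi_ne`, `eq_succ_of_odd`, `v_varpi_pow`) and ★ `WildQuadraticEisensteinFrame` (coords)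
import HarnessLib

/-!
# Norm-one elements of a ramified quadratic datum as unit quotients `α = a∕σa` (Hilbert 90 with a UNIT), the parity `v(α − 1) ≡ d (mod 2)`, and the third depth
# `aσb − bσa = (a₁b₀ − a₀b₁)(ϖ − σϖ)` (LH4-p10 (g2) MEMO-stableLaw-finite v2 §2 (L1)(L2); Serre, *Local Fields* V §3, X §1 Hilbert 90)

Topic `NumberTheory/LocalFields`; namespace `Literature.NumberTheory.LocalFields.WildQuadraticDatum` (the one-field datum of ★ `WildQuadraticDatumTrace`: `σ` an involution of a discretely
valued field `K` with `v ∘ σ = v`, non-zero `σ`-fixed elements of even valuation, `ϖ` a uniformiser, `|ϖ − σϖ| = |ϖ|^d`, `|2| = |ϖ|^t`; datum conjuncts as separate binders).  THEOREMS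
ONLY (no definition, no instance, no notation, no named fact, no `sorry`); NO completeness, NO finiteness of the residue field.  Cell `pub/hodgecm-mathlib` (D-0151), crux H413 =
`stmt-HodgeConjecture-24833`; road «(D-RAM) FOUR-FRAME», unit U3_Laws, MS ROAD A (registered stub `stub_U3_stableModelSum`), STAGE B (LH4-p10 (g2) MEMO v2 §9) brick **B0 «DATUM
LEMMAS»** — the three elementary facts about the element datum `γ = diag(α, β, 1)`, `α, β ∈ E¹`, that every class count of the (S-fin) census uses: they are typed ONCE here.

THE MATHEMATICS (`N a := a·σa`, `π := ϖσϖ`, fixed coordinates `a = a₀ + a₁ϖ` of ★ `exists_fixed_coords_of_map_ne`).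
* §0 `two_le_of_v_two_lt_one`: at a WILD place (`|2| < 1`) the different exponent is `d ≥ 2` (`d = 1` is odd, hence `d = t + 1` by ★ `eq_succ_of_odd`, so `t = 0`, `|2| = 1`) — exported
  (it sat inside ★ p855374 ∕ p855483).
* §1 HILBERT 90 for the involution: `ασα = 1 ⇒ α = a∕σa` with `a = 1 + α ≠ 0`, or `a = ϖ − σϖ` (skew) when `α = −1` (`exists_eq_div_map_of_mul_map_eq_one`); quotients are insensitive to FIXED
  rescaling (`div_map_eq_of_mul_fixed`).
* §2 UNIT QUOTIENTS ARE DEEP, `ϖ`-QUOTIENTS ARE NOT: for a unit `u`, `u − σu = u₁(ϖ − σϖ)` so `|u∕σu − 1| = |u − σu| ≤ |ϖ|^d` (`v_div_map_sub_one_eq`, `v_div_map_sub_one_le_of_v_eq_one`); for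
  `a = ϖ·u`, `a∕σa = (ϖ∕σϖ)·(u∕σu)` has `|a∕σa − 1| = |ϖ|^{d−1}` EXACTLY (`v_div_map_sub_one_eq_of_v_eq_v_varpi`).  Hence (MEMO (L1)) **`exists_unit_eq_div_map`**: if `ασα = 1` and
  `|α − 1| ≤ |ϖ|^d` then `α = a∕σa` with `|a| = 1` (the Hilbert-90 witness has EVEN valuation — odd would force depth `d − 1` — and a power of the fixed `π` rescales it to a unit), and the PARITY
  **`exists_v_sub_one_eq_pow`**: `|α − 1| = |ϖ|^{d + 2j}` for some `j : ℕ` (`α ≠ 1`): `α − 1 = a₁(ϖ − σϖ)∕σa` with `a₁ ≠ 0` fixed of even valuation.  So in-threshold depths `n_i ≥ d` all have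
  the parity of `d`, and `k = (n₁ + n₂ + n₃ + 2 − d)∕2` is an integer.
* §4 THE F-RATIONALITY DEPTH (MEMO (L3), asked by LH4-p10 (g2) 23:25:14Z): `exists_fixed_v_div_sub_le_iff` — `a∕b ≡` a FIXED element `(mod 𝔭_E^j) ⟺ |(a₁b₀ − a₀b₁)ϖ| ≤ |ϖ|^j`
  (`ν(a∕b) = 2v_F(a₁b₀ − a₀b₁) + 1`), its `σ`- and `F^×`-invariance, and the GLUE-UNIT form `exists_fixed_near_glueUnit_iff` (`(β−1)∕(α−1) = (b₁∕a₁)·σ(a∕b)`); (L4a) is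
  `v_sub_map_le_of_v_le_one` (§2), (L4b) `v_ne_varpi_pow_odd_of_fixed`.
* §3 THE THIRD DEPTH (MEMO (L2)): `(a₀ + a₁ϖ)·σ(b₀ + b₁ϖ) − (b₀ + b₁ϖ)·σ(a₀ + a₁ϖ) = (a₁b₀ − a₀b₁)·(ϖ − σϖ)` (ring identity, `sub_mul_map_sub_eq_of_coords`) and, for units `a, b`,
  `|a∕σa − b∕σb| = |aσb − bσa|` (`v_div_map_sub_div_map_eq`) — so `n₃ = v(α − β) = 2v_F(a₁b₀ − a₀b₁) + d`.
HONEST LABEL: HC_CM is proved only modulo the 7 printed citations (2 remaining named inputs: hLiu418 = stmt-HodgeConjecture-24832, h413 = stmt-HodgeConjecture-24833) until rung 0 closes;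
count-neutral helper; (MS) stays a PROVER TARGET — nothing about it is asserted here.

## References
* [Serre1979] J.-P. Serre, *Local Fields*, GTM 67 (1979): Ch. X §1 (Hilbert's Theorem 90), Ch. V §3 (the totally ramified quadratic case: `U_E^{(d)}`-depths of quotients `a∕σa`),
  Ch. I §6 Prop. 18 (`𝒪_E = 𝒪_F ⊕ 𝒪_F ϖ`).
* [Kottwitz1986BaseChangeUnits] R. E. Kottwitz, *Base change for unit elements of Hecke algebras*, Compositio Math. 60 (1986), §1 pp. 240–241 (norm-one elements of the unramified∕ramified torus).
-/

set_option autoImplicit false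

open WithZero
open scoped Valued

namespace Literature.NumberTheory.LocalFields.WildQuadraticDatum

variable {K : Type*} [Field K] [Valued K ℤᵐ⁰] {σ : K →+* K} {ϖ : K} {d t : ℕ}

/-! ## §0 A wild place has `d ≥ 2` -/

/-- **`|2| < 1 ⇒ 2 ≤ d`**: the different exponent of a ramified quadratic datum at a WILD place is at least `2` (`d ≠ 0` since `σϖ ≠ ϖ`-distance `|ϖ|^d ≤ |ϖ|`; `d = 1` is odd, so
`d = t + 1` by ★ `eq_succ_of_odd`, forcing `t = 0`, `|2| = 1`). [cite: Serre1979, Ch. V §3] -/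
theorem two_le_of_v_two_lt_one (hσ : ∀ x, σ (σ x) = x) (hvσ : ∀ a, Valued.v (σ a) = Valued.v a)
    (hfix : ∀ x : K, σ x = x → x ≠ 0 → ∃ n : ℤ, Valued.v x = exp (2 * n)) (hϖ : Valued.v ϖ = exp (-1 : ℤ))
    (hd : Valued.v (ϖ - σ ϖ) = Valued.v ϖ ^ d) (ht : Valued.v (2 : K) = Valued.v ϖ ^ t) (h2v : Valued.v (2 : K) < 1) : 2 ≤ d := by
  by_contra hlt
  have hd0 : d ≠ 0 := fun h => by
    rw [h, pow_zero] at hd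
    have h1 : Valued.v (ϖ - σ ϖ) ≤ max (Valued.v ϖ) (Valued.v (σ ϖ)) := Valuation.map_sub _ _ _
    rw [hvσ, max_self, hd, hϖ, ← exp_zero, exp_le_exp] at h1
    omega
  have hodd : Odd d := ⟨0, by omega⟩
  have hdt := eq_succ_of_odd hσ hfix hϖ hd ht hodd
  have ht0 : t = 0 := by omega
  rw [ht, ht0, pow_zero] at h2v
  exact lt_irrefl _ h2v

/-! ## §1 Hilbert 90 for the involution -/

omit [Valued K ℤᵐ⁰] in
/-- **HILBERT 90 (algebraic form)**: `α·σα = 1 ⇒ α = a∕σa` with `a ≠ 0` — `a := 1 + α` (then `α·σa = α + ασα = a`), or, when `α = −1`, any non-zero SKEW element, here `a := ϖ − σϖ`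
(non-zero by the datum clause `|ϖ − σϖ| = |ϖ|^d`, supplied as the hypothesis `hskew`). [cite: Serre1979, Ch. X §1] -/
theorem exists_eq_div_map_of_mul_map_eq_one (hσ : ∀ x, σ (σ x) = x) (hskew : ϖ - σ ϖ ≠ 0) {α : K} (hα : α * σ α = 1) :
    ∃ a : K, a ≠ 0 ∧ σ a ≠ 0 ∧ α = a / σ a := by
  by_cases h1 : 1 + α = 0
  · -- `α = −1`: a skew witness
    have hα1 : α = -1 := by linear_combination h1
    refine ⟨ϖ - σ ϖ, hskew, fun h => hskew ?_, ?_⟩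
    · rw [map_sub, hσ] at h; linear_combination (-1 : K) * h
    · rw [map_sub, hσ, hα1]
      have : σ ϖ - ϖ ≠ 0 := fun h => hskew (by linear_combination (-1 : K) * h)
      field_simp
      ring
  · have hσa : σ (1 + α) ≠ 0 := fun h => h1 (by
      have := congrArg σ h
      rwa [hσ, map_zero] at this)
    refine ⟨1 + α, h1, hσa, ?_⟩
    rw [eq_div_iff hσa, map_add, map_one, mul_add, mul_one, hα, add_comm]

omit [Valued K ℤᵐ⁰] in
/-- Quotients `a∕σa` are insensitive to a FIXED non-zero rescaling: `(a·c)∕σ(a·c) = a∕σa` for `σc = c ≠ 0`. [cite: Serre1979, Ch. X §1] -/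
theorem div_map_eq_of_mul_fixed {a c : K} (hσc : σ c = c) (hc : c ≠ 0) : (a * c) / σ (a * c) = a / σ a := by
  rw [map_mul, hσc, mul_div_mul_right _ _ hc]

/-! ## §2 Unit quotients are deep; `ϖ`-quotients have depth exactly `d − 1`; Hilbert 90 with a unit; the parity -/

/-- `|a∕σa − 1| = |a − σa|` for a unit `a`. [cite: Serre1979, Ch. V §3] -/
theorem v_div_map_sub_one_eq (hvσ : ∀ a, Valued.v (σ a) = Valued.v a) {a : K} (ha : Valued.v a = 1) :
    Valued.v (a / σ a - 1) = Valued.v (a - σ a) := by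
  have hσa0 : σ a ≠ 0 := (Valuation.ne_zero_iff _).1 (by rw [hvσ, ha]; exact one_ne_zero)
  rw [div_sub_one hσa0, map_div₀, hvσ, ha, div_one]

/-- **UNIT QUOTIENTS ARE DEEP**: for a unit `u`, `|u − σu| ≤ |ϖ|^d` (`u = u₀ + u₁ϖ` with fixed integers, `u − σu = u₁(ϖ − σϖ)`), hence `|u∕σu − 1| ≤ |ϖ|^d`. [cite: Serre1979, Ch. V §3] [cite: Serre1979, Ch. I §6 Prop. 18] -/
theorem v_sub_map_le_of_v_le_one (hσ : ∀ x, σ (σ x) = x) (hfix : ∀ x : K, σ x = x → x ≠ 0 → ∃ n : ℤ, Valued.v x = exp (2 * n))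
    (hϖ : Valued.v ϖ = exp (-1 : ℤ)) (hd : Valued.v (ϖ - σ ϖ) = Valued.v ϖ ^ d) {u : K} (hu : Valued.v u ≤ 1) :
    Valued.v (u - σ u) ≤ Valued.v ϖ ^ d := by
  obtain ⟨a, b, ha, hb, huab⟩ := exists_fixed_coords_of_map_ne hσ (map_varpi_ne hϖ hd) u
  obtain ⟨-, hb1⟩ := (v_fixed_add_fixed_mul_le_one_iff (even_log_v_of_fixed hfix) hϖ ha hb).1 (huab ▸ hu)
  have hrew : u - σ u = b * (ϖ - σ ϖ) := by rw [huab, map_add, map_mul, ha, hb]; ring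
  rw [hrew, map_mul, hd]
  calc Valued.v b * Valued.v ϖ ^ d ≤ 1 * Valued.v ϖ ^ d := mul_le_mul_left hb1 _
    _ = Valued.v ϖ ^ d := one_mul _

/-- `|u∕σu − 1| ≤ |ϖ|^d` for a unit `u`. [cite: Serre1979, Ch. V §3] -/
theorem v_div_map_sub_one_le_of_v_eq_one (hσ : ∀ x, σ (σ x) = x) (hvσ : ∀ a, Valued.v (σ a) = Valued.v a)
    (hfix : ∀ x : K, σ x = x → x ≠ 0 → ∃ n : ℤ, Valued.v x = exp (2 * n)) (hϖ : Valued.v ϖ = exp (-1 : ℤ))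
    (hd : Valued.v (ϖ - σ ϖ) = Valued.v ϖ ^ d) {u : K} (hu : Valued.v u = 1) :
    Valued.v (u / σ u - 1) ≤ Valued.v ϖ ^ d := by
  rw [v_div_map_sub_one_eq hvσ hu]
  exact v_sub_map_le_of_v_le_one hσ hfix hϖ hd hu.le

/-- **`ϖ`-QUOTIENTS HAVE DEPTH EXACTLY `d − 1`**: if `|a| = |ϖ|` then `|a∕σa − 1| = |ϖ|^{d−1}` on the nose (`a = ϖu`, `a∕σa = (ϖ∕σϖ)(u∕σu)`, `|ϖ∕σϖ − 1| = |ϖ|^{d−1} > |ϖ|^d ≥ |u∕σu − 1|`).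
Requires `1 ≤ d` (the datum clause). [cite: Serre1979, Ch. V §3] -/
theorem v_div_map_sub_one_eq_of_v_eq_v_varpi (hσ : ∀ x, σ (σ x) = x) (hvσ : ∀ a, Valued.v (σ a) = Valued.v a)
    (hfix : ∀ x : K, σ x = x → x ≠ 0 → ∃ n : ℤ, Valued.v x = exp (2 * n)) (hϖ : Valued.v ϖ = exp (-1 : ℤ))
    (hd : Valued.v (ϖ - σ ϖ) = Valued.v ϖ ^ d) (hd1 : 1 ≤ d) {a : K} (ha : Valued.v a = Valued.v ϖ) :
    Valued.v (a / σ a - 1) = Valued.v ϖ ^ (d - 1) := by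
  have hϖ0 : ϖ ≠ 0 := fun h => by rw [h, map_zero] at hϖ; exact (exp_ne_zero hϖ.symm).elim
  have hσϖ0 : σ ϖ ≠ 0 := (map_ne_zero σ).2 hϖ0
  have ha0 : a ≠ 0 := (Valuation.ne_zero_iff _).1 (by rw [ha]; exact (Valuation.ne_zero_iff _).2 hϖ0)
  have hσa0 : σ a ≠ 0 := (map_ne_zero σ).2 ha0
  -- `u := a ∕ ϖ` is a unit
  have hu : Valued.v (a / ϖ) = 1 := by rw [map_div₀, ha, div_self ((Valuation.ne_zero_iff _).2 hϖ0)]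
  have hσu0 : σ (a / ϖ) ≠ 0 := (map_ne_zero σ).2 (div_ne_zero ha0 hϖ0)
  -- `a∕σa − 1 = (ϖ∕σϖ − 1)·(u∕σu) + (u∕σu − 1)`
  have hsplit : a / σ a - 1 = (ϖ / σ ϖ - 1) * ((a / ϖ) / σ (a / ϖ)) + ((a / ϖ) / σ (a / ϖ) - 1) := by
    rw [map_div₀]
    field_simp
    ring
  have hρ : Valued.v (ϖ / σ ϖ - 1) = Valued.v ϖ ^ (d - 1) := by
    rw [div_sub_one hσϖ0, map_div₀, hd, hvσ]
    conv_lhs => rw [show d = d - 1 + 1 by omega, pow_succ]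
    rw [mul_div_assoc, div_self ((Valuation.ne_zero_iff _).2 hϖ0), mul_one]
  have hq1 : Valued.v ((a / ϖ) / σ (a / ϖ)) = 1 := by rw [map_div₀, hvσ, hu, div_one]
  have hq : Valued.v ((a / ϖ) / σ (a / ϖ) - 1) ≤ Valued.v ϖ ^ d := v_div_map_sub_one_le_of_v_eq_one hσ hvσ hfix hϖ hd hu
  have hlt : Valued.v ((a / ϖ) / σ (a / ϖ) - 1) < Valued.v ((ϖ / σ ϖ - 1) * ((a / ϖ) / σ (a / ϖ))) := by
    rw [map_mul, hρ, hq1, mul_one]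
    refine lt_of_le_of_lt hq ?_
    rw [v_varpi_pow hϖ, v_varpi_pow hϖ, exp_lt_exp]; omega
  rw [hsplit, Valuation.map_add_eq_of_lt_left _ hlt, map_mul, hρ, hq1, mul_one]

/-- **HILBERT 90 WITH A UNIT (MEMO v2 (L1))**: in a ramified quadratic datum, a norm-one element `α` (`ασα = 1`) of depth `|α − 1| ≤ |ϖ|^d` is `a∕σa` for a UNIT `a`.  (The Hilbert-90 witness
`a₀` has even valuation `2m` — an odd one would give depth `d − 1` exactly by `v_div_map_sub_one_eq_of_v_eq_v_varpi` — and the fixed scalar `(ϖσϖ)^{m}` rescales it to a unit without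
changing the quotient.) [cite: Serre1979, Ch. V §3] [cite: Serre1979, Ch. X §1] [cite: Kottwitz1986BaseChangeUnits, §1 pp. 240–241] -/
theorem exists_unit_eq_div_map (hσ : ∀ x, σ (σ x) = x) (hvσ : ∀ a, Valued.v (σ a) = Valued.v a)
    (hfix : ∀ x : K, σ x = x → x ≠ 0 → ∃ n : ℤ, Valued.v x = exp (2 * n)) (hϖ : Valued.v ϖ = exp (-1 : ℤ))
    (hd : Valued.v (ϖ - σ ϖ) = Valued.v ϖ ^ d) (hd1 : 1 ≤ d) {α : K} (hα : α * σ α = 1) (hdepth : Valued.v (α - 1) ≤ Valued.v ϖ ^ d) :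
    ∃ a : K, Valued.v a = 1 ∧ α = a / σ a := by
  have hϖ0 : ϖ ≠ 0 := fun h => by rw [h, map_zero] at hϖ; exact (exp_ne_zero hϖ.symm).elim
  have hσϖ0 : σ ϖ ≠ 0 := (map_ne_zero σ).2 hϖ0
  have hπ0 : ϖ * σ ϖ ≠ 0 := mul_ne_zero hϖ0 hσϖ0
  have hσπ : σ (ϖ * σ ϖ) = ϖ * σ ϖ := map_mul_map hσ ϖ
  have hvπ : ∀ m : ℤ, Valued.v ((ϖ * σ ϖ) ^ m) = exp (-(2 * m)) := fun m => by
    rw [map_zpow₀, map_mul, hvσ, hϖ, ← exp_add, ← exp_zsmul]; congr 1; ring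
  obtain ⟨a₀, ha₀, hσa₀, hαa₀⟩ := exists_eq_div_map_of_mul_map_eq_one hσ (sub_map_ne_zero hϖ hd) hα
  have hva₀ : Valued.v a₀ ≠ 0 := (Valuation.ne_zero_iff _).2 ha₀
  set e : ℤ := log (Valued.v a₀) with he
  have hve : Valued.v a₀ = exp e := (exp_log hva₀).symm
  rcases Int.even_or_odd e with ⟨m, hm⟩ | ⟨m, hm⟩
  · -- even valuation `e = 2m`: rescale by the fixed `π^{m}` (`|π| = exp(−2)`)
    refine ⟨a₀ * (ϖ * σ ϖ) ^ m, ?_, ?_⟩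
    · rw [map_mul, hve, hvπ, ← exp_add, ← exp_zero]; congr 1; omega
    · rw [hαa₀, div_map_eq_of_mul_fixed (by rw [map_zpow₀, hσπ]) (zpow_ne_zero _ hπ0)]
  · -- odd valuation `e = 2m + 1` is impossible: the quotient would have depth exactly `d − 1`
    exfalso
    -- `b := a₀ · π^{m+1}` has `|b| = |ϖ|` and the same quotient
    have hvb : Valued.v (a₀ * (ϖ * σ ϖ) ^ (m + 1)) = Valued.v ϖ := by
      rw [map_mul, hve, hvπ, hϖ, ← exp_add]; congr 1; omega
    have hαb : α = (a₀ * (ϖ * σ ϖ) ^ (m + 1)) / σ (a₀ * (ϖ * σ ϖ) ^ (m + 1)) := by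
      rw [hαa₀, div_map_eq_of_mul_fixed (by rw [map_zpow₀, hσπ]) (zpow_ne_zero _ hπ0)]
    have hexact := v_div_map_sub_one_eq_of_v_eq_v_varpi hσ hvσ hfix hϖ hd hd1 hvb
    rw [← hαb] at hexact
    rw [hexact, v_varpi_pow hϖ, v_varpi_pow hϖ, exp_le_exp] at hdepth
    omega

/-- **THE PARITY `v(α − 1) ≡ d (mod 2)` (MEMO v2 (L1))**: for a norm-one `α ≠ 1` with `|α − 1| ≤ |ϖ|^d`: `|α − 1| = |ϖ|^{d + 2j}` for some `j : ℕ` — `α = a∕σa` with `a = a₀ + a₁ϖ` a unit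
in fixed coordinates, `α − 1 = a₁(ϖ − σϖ)∕σa`, `a₁ ≠ 0` fixed integral of even valuation.  So all in-threshold root depths `n_i ≥ d` share the parity of `d` and `k = (Σn + 2 − d)∕2 ∈ ℕ`.
[cite: Serre1979, Ch. V §3] [cite: Serre1979, Ch. I §6 Prop. 18] -/
theorem exists_v_sub_one_eq_pow (hσ : ∀ x, σ (σ x) = x) (hvσ : ∀ a, Valued.v (σ a) = Valued.v a)
    (hfix : ∀ x : K, σ x = x → x ≠ 0 → ∃ n : ℤ, Valued.v x = exp (2 * n)) (hϖ : Valued.v ϖ = exp (-1 : ℤ))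
    (hd : Valued.v (ϖ - σ ϖ) = Valued.v ϖ ^ d) (hd1 : 1 ≤ d) {α : K} (hα : α * σ α = 1) (hdepth : Valued.v (α - 1) ≤ Valued.v ϖ ^ d) (hα1 : α ≠ 1) :
    ∃ j : ℕ, Valued.v (α - 1) = Valued.v ϖ ^ (d + 2 * j) := by
  obtain ⟨a, hva, hαa⟩ := exists_unit_eq_div_map hσ hvσ hfix hϖ hd hd1 hα hdepth
  have hσa0 : σ a ≠ 0 := (Valuation.ne_zero_iff _).1 (by rw [hvσ, hva]; exact one_ne_zero)
  -- fixed coordinates of the unit `a`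
  obtain ⟨a₀, a₁, ha₀, ha₁, haco⟩ := exists_fixed_coords_of_map_ne hσ (map_varpi_ne hϖ hd) a
  obtain ⟨-, ha₁1⟩ := (v_fixed_add_fixed_mul_le_one_iff (even_log_v_of_fixed hfix) hϖ ha₀ ha₁).1 (haco ▸ hva.le)
  have hsub : a - σ a = a₁ * (ϖ - σ ϖ) := by rw [haco, map_add, map_mul, ha₀, ha₁]; ring
  have ha₁0 : a₁ ≠ 0 := by
    intro h0
    apply hα1
    rw [hαa, div_eq_one_iff_eq hσa0]
    have : a - σ a = 0 := by rw [hsub, h0, zero_mul]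
    linear_combination this
  obtain ⟨n, hn⟩ := hfix a₁ ha₁ ha₁0
  have hn0 : n ≤ 0 := by
    have h := ha₁1
    rw [hn, ← exp_zero, exp_le_exp] at h
    omega
  refine ⟨(-n).toNat, ?_⟩
  rw [hαa, v_div_map_sub_one_eq hvσ hva, hsub, map_mul, hn, hd, v_varpi_pow hϖ, v_varpi_pow hϖ, ← exp_add]
  congr 1
  push_cast
  omega

/-! ## §3 The third depth: `aσb − bσa` in fixed coordinates -/

omit [Valued K ℤᵐ⁰] in
/-- **`(a₀ + a₁ϖ)·σ(b₀ + b₁ϖ) − (b₀ + b₁ϖ)·σ(a₀ + a₁ϖ) = (a₁b₀ − a₀b₁)·(ϖ − σϖ)`** for `σ`-fixed `a₀ a₁ b₀ b₁` (MEMO v2 (L2); a ring identity). [cite: Serre1979, Ch. I §6 Prop. 18] -/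
theorem sub_mul_map_sub_eq_of_coords {a₀ a₁ b₀ b₁ : K} (ha₀ : σ a₀ = a₀) (ha₁ : σ a₁ = a₁) (hb₀ : σ b₀ = b₀) (hb₁ : σ b₁ = b₁) :
    (a₀ + a₁ * ϖ) * σ (b₀ + b₁ * ϖ) - (b₀ + b₁ * ϖ) * σ (a₀ + a₁ * ϖ) = (a₁ * b₀ - a₀ * b₁) * (ϖ - σ ϖ) := by
  rw [map_add, map_mul, hb₀, hb₁, map_add, map_mul, ha₀, ha₁]
  ring

/-- **`|a∕σa − b∕σb| = |aσb − bσa|`** for units `a, b` (so, with §3's identity, `n₃ = v(α − β) = 2v_F(a₁b₀ − a₀b₁) + d` for `α = a∕σa`, `β = b∕σb`; MEMO v2 (L2)). [cite: Serre1979, Ch. V §3] -/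
theorem v_div_map_sub_div_map_eq (hvσ : ∀ a, Valued.v (σ a) = Valued.v a) {a b : K} (ha : Valued.v a = 1) (hb : Valued.v b = 1) :
    Valued.v (a / σ a - b / σ b) = Valued.v (a * σ b - b * σ a) := by
  have hσa0 : σ a ≠ 0 := (Valuation.ne_zero_iff _).1 (by rw [hvσ, ha]; exact one_ne_zero)
  have hσb0 : σ b ≠ 0 := (Valuation.ne_zero_iff _).1 (by rw [hvσ, hb]; exact one_ne_zero)
  rw [div_sub_div _ _ hσa0 hσb0, map_div₀, map_mul, hvσ, hvσ, ha, hb, mul_one, div_one]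
  congr 1
  ring

/-- **THE THIRD DEPTH IN COORDINATES**: for units `a = a₀ + a₁ϖ`, `b = b₀ + b₁ϖ` (fixed coordinates), `|a∕σa − b∕σb| = |a₁b₀ − a₀b₁|·|ϖ|^d`. [cite: Serre1979, Ch. V §3] [cite: Serre1979, Ch. I §6 Prop. 18] -/
theorem v_div_map_sub_div_map_eq_of_coords (hvσ : ∀ a, Valued.v (σ a) = Valued.v a) (hd : Valued.v (ϖ - σ ϖ) = Valued.v ϖ ^ d)
    {a₀ a₁ b₀ b₁ : K} (ha₀ : σ a₀ = a₀) (ha₁ : σ a₁ = a₁) (hb₀ : σ b₀ = b₀) (hb₁ : σ b₁ = b₁)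
    (ha : Valued.v (a₀ + a₁ * ϖ) = 1) (hb : Valued.v (b₀ + b₁ * ϖ) = 1) :
    Valued.v ((a₀ + a₁ * ϖ) / σ (a₀ + a₁ * ϖ) - (b₀ + b₁ * ϖ) / σ (b₀ + b₁ * ϖ)) = Valued.v (a₁ * b₀ - a₀ * b₁) * Valued.v ϖ ^ d := by
  rw [v_div_map_sub_div_map_eq hvσ ha hb, sub_mul_map_sub_eq_of_coords ha₀ ha₁ hb₀ hb₁, map_mul, hd]

/-! ## §4 The F-rationality depth of a unit quotient `a∕b` and of the glue unit (MEMO v2 (L3)) -/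

omit [Valued K ℤᵐ⁰] in
/-- **`aσb` IN FIXED COORDINATES**: `(a₀ + a₁ϖ)·σ(b₀ + b₁ϖ) = (a₀b₀ + a₁b₁·ϖσϖ + a₀b₁·(ϖ + σϖ)) + (a₁b₀ − a₀b₁)·ϖ` — the `ϖ`-coordinate of `aσb` (hence of `a∕b = aσb∕N b`) is
`a₁b₀ − a₀b₁` (ring identity; `σϖ = Tr ϖ − ϖ`). [cite: Serre1979, Ch. I §6 Prop. 18] -/
theorem mul_map_eq_coords {a₀ a₁ b₀ b₁ : K} (hb₀ : σ b₀ = b₀) (hb₁ : σ b₁ = b₁) :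
    (a₀ + a₁ * ϖ) * σ (b₀ + b₁ * ϖ) = (a₀ * b₀ + a₁ * b₁ * (ϖ * σ ϖ) + a₀ * b₁ * (ϖ + σ ϖ)) + (a₁ * b₀ - a₀ * b₁) * ϖ := by
  rw [map_add, map_mul, hb₀, hb₁]
  ring

/-- **THE F-RATIONALITY DEPTH OF A UNIT QUOTIENT (MEMO v2 (L3))**: for `a = a₀ + a₁ϖ` and a UNIT `b = b₀ + b₁ϖ` in fixed coordinates and every `j : ℕ`,
`a∕b` is congruent to a `σ`-FIXED element modulo `𝔭_E^j` iff `|(a₁b₀ − a₀b₁)·ϖ| ≤ |ϖ|^j` — i.e. `ν(a∕b) = 2v_F(a₁b₀ − a₀b₁) + 1`: `a∕b = u₀ + u₁ϖ` with `u₁ = (a₁b₀ − a₀b₁)∕N b`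
(`mul_map_eq_coords`); `⟸` with `f = u₀`; `⟹` because for fixed `f` the two summands of `(u₀ − f) + u₁ϖ` have valuations of DIFFERENT parity (★ `v_fixed_add_fixed_mul_eq_max`), so
`|a∕b − f| ≥ |u₁ϖ|`. [cite: Serre1979, Ch. I §6 Prop. 18] [cite: Serre1979, Ch. V §3] -/
theorem exists_fixed_v_div_sub_le_iff (hσ : ∀ x, σ (σ x) = x) (hvσ : ∀ a, Valued.v (σ a) = Valued.v a)
    (hfix : ∀ x : K, σ x = x → x ≠ 0 → ∃ n : ℤ, Valued.v x = exp (2 * n)) (hϖ : Valued.v ϖ = exp (-1 : ℤ))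
    {a₀ a₁ b₀ b₁ : K} (ha₀ : σ a₀ = a₀) (ha₁ : σ a₁ = a₁) (hb₀ : σ b₀ = b₀) (hb₁ : σ b₁ = b₁) (hb : Valued.v (b₀ + b₁ * ϖ) = 1) (j : ℕ) :
    (∃ f : K, σ f = f ∧ Valued.v ((a₀ + a₁ * ϖ) / (b₀ + b₁ * ϖ) - f) ≤ Valued.v ϖ ^ j) ↔
      Valued.v ((a₁ * b₀ - a₀ * b₁) * ϖ) ≤ Valued.v ϖ ^ j := by
  have hfix' := even_log_v_of_fixed hfix
  set b : K := b₀ + b₁ * ϖ with hbdef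
  have hb0 : b ≠ 0 := (Valuation.ne_zero_iff _).1 (by rw [hb]; exact one_ne_zero)
  have hσb0 : σ b ≠ 0 := (map_ne_zero σ).2 hb0
  have hN1 : Valued.v (b * σ b) = 1 := by rw [map_mul, hvσ, hb, mul_one]
  have hN0 : b * σ b ≠ 0 := mul_ne_zero hb0 hσb0
  have hσN : σ (b * σ b) = b * σ b := map_mul_map hσ b
  -- the fixed coordinates `u₀`, `u₁` of `a ∕ b = aσb ∕ N b`
  set c₀ : K := a₀ * b₀ + a₁ * b₁ * (ϖ * σ ϖ) + a₀ * b₁ * (ϖ + σ ϖ) with hc₀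
  set c₁ : K := a₁ * b₀ - a₀ * b₁ with hc₁
  have hσc₀ : σ c₀ = c₀ := by
    rw [hc₀]
    simp only [map_add, map_mul, ha₀, ha₁, hb₀, hb₁, hσ]
    ring
  have hσc₁ : σ c₁ = c₁ := by rw [hc₁, map_sub, map_mul, map_mul, ha₀, ha₁, hb₀, hb₁]
  have hu : (a₀ + a₁ * ϖ) / b = c₀ / (b * σ b) + c₁ / (b * σ b) * ϖ := by
    have hnum : (a₀ + a₁ * ϖ) * σ b = c₀ + c₁ * ϖ := by rw [hbdef, mul_map_eq_coords hb₀ hb₁]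
    field_simp
    linear_combination hnum
  have hσu₀ : σ (c₀ / (b * σ b)) = c₀ / (b * σ b) := by rw [map_div₀, hσc₀, hσN]
  have hσu₁ : σ (c₁ / (b * σ b)) = c₁ / (b * σ b) := by rw [map_div₀, hσc₁, hσN]
  have hvu₁ : Valued.v (c₁ / (b * σ b) * ϖ) = Valued.v (c₁ * ϖ) := by rw [map_mul, map_div₀, hN1, div_one, map_mul]
  constructor
  · rintro ⟨f, hσf, hf⟩
    have hrew : (a₀ + a₁ * ϖ) / b - f = (c₀ / (b * σ b) - f) + c₁ / (b * σ b) * ϖ := by rw [hu]; ring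
    rw [hrew, v_fixed_add_fixed_mul_eq_max hfix' hϖ (by rw [map_sub, hσu₀, hσf]) hσu₁] at hf
    have h2 := le_trans (le_max_right _ _) hf
    rwa [← hϖ, ← map_mul, hvu₁] at h2
  · intro h
    refine ⟨c₀ / (b * σ b), hσu₀, ?_⟩
    rw [hu, add_sub_cancel_left, hvu₁]
    exact h

/-- F-RATIONALITY DEPTH IS `σ`-INVARIANT: `u` is within `r` of a fixed element iff `σu` is. [cite: Serre1979, Ch. V §3] -/
theorem exists_fixed_v_map_sub_le_iff (hvσ : ∀ a, Valued.v (σ a) = Valued.v a) (u : K) (r : ℤᵐ⁰) :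
    (∃ f : K, σ f = f ∧ Valued.v (σ u - f) ≤ r) ↔ (∃ f : K, σ f = f ∧ Valued.v (u - f) ≤ r) := by
  constructor
  · rintro ⟨f, hσf, hf⟩
    refine ⟨f, hσf, ?_⟩
    rw [← hvσ, map_sub, hσf]; exact hf
  · rintro ⟨f, hσf, hf⟩
    refine ⟨f, hσf, ?_⟩
    have : σ u - f = σ (u - f) := by rw [map_sub, hσf]
    rw [this, hvσ]; exact hf

/-- F-RATIONALITY DEPTH IS INVARIANT UNDER FIXED RESCALING: for fixed `c ≠ 0`, `c·u` is within `|c|·r` of a fixed element iff `u` is within `r` of one. [cite: Serre1979, Ch. V §3] -/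
theorem exists_fixed_v_mul_sub_le_iff {c : K} (hσc : σ c = c) (hc : c ≠ 0) (u : K) (r : ℤᵐ⁰) :
    (∃ f : K, σ f = f ∧ Valued.v (c * u - f) ≤ Valued.v c * r) ↔ (∃ f : K, σ f = f ∧ Valued.v (u - f) ≤ r) := by
  have hvc : Valued.v c ≠ 0 := (Valuation.ne_zero_iff _).2 hc
  have hvc' : 0 < Valued.v c := zero_lt_iff.2 hvc
  constructor
  · rintro ⟨f, hσf, hf⟩
    refine ⟨f / c, by rw [map_div₀, hσf, hσc], ?_⟩
    have hrew : u - f / c = c⁻¹ * (c * u - f) := by field_simp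
    rw [hrew, map_mul, map_inv₀]
    calc (Valued.v c)⁻¹ * Valued.v (c * u - f) ≤ (Valued.v c)⁻¹ * (Valued.v c * r) := mul_le_mul_right hf _
      _ = r := by rw [← mul_assoc, inv_mul_cancel₀ hvc, one_mul]
  · rintro ⟨f, hσf, hf⟩
    refine ⟨c * f, by rw [map_mul, hσc, hσf], ?_⟩
    rw [← mul_sub, map_mul]
    exact mul_le_mul_right hf _

/-- **THE GLUE UNIT (MEMO v2 (L3), element currency)**: for units `a = a₀ + a₁ϖ`, `b = b₀ + b₁ϖ` in fixed coordinates with `a₁ ≠ 0`, `b₁ ≠ 0`, the «glue unit» of `α = a∕σa`, `β = b∕σb` is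
`(β − 1)∕(α − 1) = (b₁∕a₁)·σ(a∕b)` (`α − 1 = a₁(ϖ − σϖ)∕σa`, `β − 1 = b₁(ϖ − σϖ)∕σb`), so its RELATIVE F-rationality depth is that of `a∕b`: for every `j : ℕ`,
`(∃ f fixed, |(β−1)∕(α−1) − f| ≤ |(β−1)∕(α−1)|·|ϖ|^j) ⟺ |(a₁b₀ − a₀b₁)ϖ| ≤ |ϖ|^j` — with §3 (`|α − β| = |a₁b₀ − a₀b₁|·|ϖ|^d = |ϖ|^{n₃}`) this reads `j ≤ n₃ + 1 − d`.
[cite: Serre1979, Ch. V §3] [cite: Kottwitz1986BaseChangeUnits, §1 pp. 240–241] -/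
theorem exists_fixed_near_glueUnit_iff (hσ : ∀ x, σ (σ x) = x) (hvσ : ∀ a, Valued.v (σ a) = Valued.v a)
    (hfix : ∀ x : K, σ x = x → x ≠ 0 → ∃ n : ℤ, Valued.v x = exp (2 * n)) (hϖ : Valued.v ϖ = exp (-1 : ℤ)) (hd : Valued.v (ϖ - σ ϖ) = Valued.v ϖ ^ d)
    {a₀ a₁ b₀ b₁ : K} (ha₀ : σ a₀ = a₀) (ha₁ : σ a₁ = a₁) (hb₀ : σ b₀ = b₀) (hb₁ : σ b₁ = b₁) (ha₁0 : a₁ ≠ 0) (hb₁0 : b₁ ≠ 0)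
    (ha : Valued.v (a₀ + a₁ * ϖ) = 1) (hb : Valued.v (b₀ + b₁ * ϖ) = 1) (j : ℕ) :
    (∃ f : K, σ f = f ∧
        Valued.v (((b₀ + b₁ * ϖ) / σ (b₀ + b₁ * ϖ) - 1) / ((a₀ + a₁ * ϖ) / σ (a₀ + a₁ * ϖ) - 1) - f) ≤
          Valued.v (((b₀ + b₁ * ϖ) / σ (b₀ + b₁ * ϖ) - 1) / ((a₀ + a₁ * ϖ) / σ (a₀ + a₁ * ϖ) - 1)) * Valued.v ϖ ^ j) ↔
      Valued.v ((a₁ * b₀ - a₀ * b₁) * ϖ) ≤ Valued.v ϖ ^ j := by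
  set a : K := a₀ + a₁ * ϖ with hadef
  set b : K := b₀ + b₁ * ϖ with hbdef
  have hskew : ϖ - σ ϖ ≠ 0 := sub_map_ne_zero hϖ hd
  have ha0 : a ≠ 0 := (Valuation.ne_zero_iff _).1 (by rw [ha]; exact one_ne_zero)
  have hb0 : b ≠ 0 := (Valuation.ne_zero_iff _).1 (by rw [hb]; exact one_ne_zero)
  have hσa0 : σ a ≠ 0 := (map_ne_zero σ).2 ha0
  have hσb0 : σ b ≠ 0 := (map_ne_zero σ).2 hb0
  -- `α − 1 = a₁(ϖ − σϖ)∕σa`, `β − 1 = b₁(ϖ − σϖ)∕σb`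
  have hα : a / σ a - 1 = a₁ * (ϖ - σ ϖ) / σ a := by
    rw [div_sub_one hσa0, hadef, map_add, map_mul, ha₀, ha₁]; ring
  have hβ : b / σ b - 1 = b₁ * (ϖ - σ ϖ) / σ b := by
    rw [div_sub_one hσb0, hbdef, map_add, map_mul, hb₀, hb₁]; ring
  -- the glue unit is `c · σ(a∕b)` with the fixed scalar `c = b₁∕a₁`
  have hg : (b / σ b - 1) / (a / σ a - 1) = (b₁ / a₁) * σ (a / b) := by
    rw [hα, hβ, map_div₀]
    field_simp
  have hσc : σ (b₁ / a₁) = b₁ / a₁ := by rw [map_div₀, ha₁, hb₁]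
  have hc0 : b₁ / a₁ ≠ 0 := div_ne_zero hb₁0 ha₁0
  have hvq : Valued.v (σ (a / b)) = 1 := by rw [hvσ, map_div₀, ha, hb, div_one]
  rw [hg, map_mul, hvq, mul_one, exists_fixed_v_mul_sub_le_iff hσc hc0, exists_fixed_v_map_sub_le_iff hvσ, hadef, hbdef]
  exact exists_fixed_v_div_sub_le_iff hσ hvσ hfix hϖ ha₀ ha₁ hb₀ hb₁ hb j

/-- (L4b) A `σ`-FIXED element never has ODD valuation: `|f| ≠ |ϖ|^{2j+1}`. [cite: Serre1979, Ch. I §6 Prop. 18] -/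
theorem v_ne_varpi_pow_odd_of_fixed (hfix : ∀ x : K, σ x = x → x ≠ 0 → ∃ n : ℤ, Valued.v x = exp (2 * n)) (hϖ : Valued.v ϖ = exp (-1 : ℤ))
    {f : K} (hσf : σ f = f) (j : ℕ) : Valued.v f ≠ Valued.v ϖ ^ (2 * j + 1) := by
  intro h
  rcases eq_or_ne f 0 with rfl | hf0
  · rw [map_zero, v_varpi_pow hϖ] at h; exact exp_ne_zero h.symm
  · obtain ⟨n, hn⟩ := hfix f hσf hf0
    rw [hn, v_varpi_pow hϖ, exp_inj] at h
    omega

/-! ## §5 ISOCELES: the three root depths `v(α−1), v(β−1), v(α−β)` attain their minimum at least twice (appended for LH4-p10 (g2) SPEC-StageB v1) -/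

omit [Valued K ℤᵐ⁰] in
/-- `α − β = (α − 1) − (β − 1)`. [cite: Serre1979, Ch. V §3] -/
theorem sub_eq_sub_one_sub_sub_one (α β : K) : α - β = (α - 1) - (β - 1) := by ring

/-- **ISOCELES (i)**: `|α − β| ≤ max |α − 1| |β − 1|` — the root depth `n₃ = v(α − β)` is at least `min(n₁, n₂)`. [cite: Serre1979, Ch. V §3] -/
theorem v_sub_le_max_v_sub_one (α β : K) : Valued.v (α - β) ≤ max (Valued.v (α - 1)) (Valued.v (β - 1)) := by
  rw [sub_eq_sub_one_sub_sub_one α β]; exact Valuation.map_sub _ _ _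

/-- **ISOCELES (ii)**: `|α − 1| ≤ max |α − β| |β − 1|`. [cite: Serre1979, Ch. V §3] -/
theorem v_sub_one_le_max_left (α β : K) : Valued.v (α - 1) ≤ max (Valued.v (α - β)) (Valued.v (β - 1)) := by
  have h : α - 1 = (α - β) + (β - 1) := by ring
  rw [h]; exact Valuation.map_add _ _ _

/-- **ISOCELES (iii)**: `|β − 1| ≤ max |α − β| |α − 1|`. [cite: Serre1979, Ch. V §3] -/
theorem v_sub_one_le_max_right (α β : K) : Valued.v (β - 1) ≤ max (Valued.v (α - β)) (Valued.v (α - 1)) := by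
  have h : β - 1 = (α - 1) - (α - β) := by ring
  rw [h, max_comm]; exact Valuation.map_sub _ _ _

/-- **ISOCELES, exponent form**: if `|α − 1| = |ϖ|^{n₂}`, `|β − 1| = |ϖ|^{n₁}`, `|α − β| = |ϖ|^{n₃}` then the minimum of `n₁, n₂, n₃` is attained at least twice:
`min n₁ n₂ ≤ n₃ ∧ min n₃ n₁ ≤ n₂ ∧ min n₃ n₂ ≤ n₁` (so either all three are equal — EQUILATERAL — or two are equal and the third is larger). [cite: Serre1979, Ch. V §3] -/
theorem isoceles_depths (hϖ : Valued.v ϖ = exp (-1 : ℤ)) {α β : K} {n₁ n₂ n₃ : ℕ}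
    (h₁ : Valued.v (β - 1) = Valued.v ϖ ^ n₁) (h₂ : Valued.v (α - 1) = Valued.v ϖ ^ n₂) (h₃ : Valued.v (α - β) = Valued.v ϖ ^ n₃) :
    min n₁ n₂ ≤ n₃ ∧ min n₃ n₁ ≤ n₂ ∧ min n₃ n₂ ≤ n₁ := by
  have e : ∀ n : ℕ, Valued.v ϖ ^ n = exp (-(n : ℤ)) := v_varpi_pow hϖ
  have hi := v_sub_le_max_v_sub_one α β
  have hii := v_sub_one_le_max_left α β
  have hiii := v_sub_one_le_max_right α β
  rw [h₁, h₂, h₃, e, e, e] at hi hii hiii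
  refine ⟨?_, ?_, ?_⟩
  · rcases le_max_iff.1 hi with h | h <;> rw [exp_le_exp] at h <;> omega
  · rcases le_max_iff.1 hii with h | h <;> rw [exp_le_exp] at h <;> omega
  · rcases le_max_iff.1 hiii with h | h <;> rw [exp_le_exp] at h <;> omega

end Literature.NumberTheory.LocalFields.WildQuadraticDatum
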